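import Literature.NumberTheory.LFunctions.EvenCharacterDoubleSumBound
import HarnessLib

/-!
# Second-order partial summation against an even primitive real character
# (Louboutin, C. R. Acad. Sci. 332 (2001) Thm 1; Bordignon, J. Number Theory 210 (2020) Thm 2.1) — PROVED

Topic `Literature/NumberTheory/LFunctions`; namespace `Literature.NumberTheory.LFunctions.DirichletAbel`
(continuing `EvenCharacterDoubleSumBound.lean`: `S₂ = doubleSum χ`, Louboutin's Lemma 10). One
definition (`secondDiff f n = f(n) − 2f(n+1) + f(n+2)`) and THEOREMS; no named fact, no `sorry`. Typed
for the cell `parity-realchar` (D-0088 (4) row (7)): this is the summation device behind Bordignon's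
`|L′(σ,χ)| ≤ ⅛ log²q` for even characters (2020 Thm 1.1, file `ExplicitExceptionalZeroBoundsRealCharacters.lean`).

## Source, as printed

M. Bordignon, J. Number Theory **210** (2020) 481–487 = arXiv:1907.08327v1 [Bordignon2020], §2.2 p. 4:
«The main result used is the following one, that is Theorem 1 in [6] [Louboutin, C. R. Acad. Sci. Paris
332 (2001) 95–98], with the left-hand side sum starting from 4. … **Theorem 2.1.** Take `χ` a even
primitive Dirichlet character, with conductor `q`. Let `A := ⌊√q⌋ − 1`. Let `f` be defined in `[4, ∞)`,
`↘ 0` and such that `f(n) − 2f(n+1) + f(n+2) ≥ 0` for all `n ≥ 4`. Then, with `0 ≤ θ ≤ 1`,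
`|∑_{4}^{∞} χ(n)f(n)| ≤ (∑_{4}^{A} f(n)) − (A/2)f(A) + (A/2){f(A) − f(A+1)} + ½f(A+1)
 + (θ/2){(A+1)(f(A+1) − f(A+2)) + f(A+2)} + 18f(4) − 12f(5)`.
*Proof.* … Define `S(n) = ∑_{a=1}^{n} ∑_{k=1}^{a} χ(k)`. We have `χ(n) = S(n) − 2S(n−1) + S(n−2)`, and,
with `a_n = f(n) − 2f(n+1) + f(n+2)`, this gives
`∑_{n≥k} f(n)χ(n) = ∑_{n≥k} a_n S(n) − 2f(k)S(k−1) + f(k)S(k−2) + f(k+1)S(k−1)`. (8) For `k ≤ A`,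
`∑_{n≥k} a_n S(n) = ∑_{k}^{A} a_n S(n) + ∑_{n>A} a_n S(n)`. Now, using that `S(n) ≤ n(n+1)/2` and
`f(n) − 2f(n+1) + f(n+2) ≥ 0`, we have `|∑_{k}^{A} a_n S(n)| ≤ ∑_{k}^{A} (n(n+1)/2) a_n = ∑_{k+2}^{A} f(n)
 + ((k+1)(k+2)/2)f(k+1) + (k(k+1)/2)f(k) − (2k(k+1)/2)f(k+1) − (A(A+3)/2)f(A+1) + (A(A+1)/2)f(A+2)` …
Now, with `k = 4`, the result follows as in Louboutin's proof.» (The C. R. note [Louboutin 2001] itself is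
paywalled, acq-13733; its character-sum input is Louboutin, Acta Arith. 101 (2002) Lemma 10, PROVED in
`EvenCharacterDoubleSumBound.lean`.)

## What is proved, and how the printed statement is read

* The tail `∑_{n>A} a_n S₂(n)` is bounded through `2|S₂(n)| ≤ n√q` (Lemma 10) and the telescoping
  `∑_{n≥A+1} n a_n ≤ (A+1)f(A+1) − A f(A+2)` (`sum_nat_mul_secondDiff(_le)`); the head through
  `|S₂(n)| ≤ n(n+1)/2` and the displayed closed form (`sum_triangular_mul_secondDiff`, valid for `A ≥ 5`);
  the boundary term of (8) at `k = 4` is `−2f(4)S₂(3) + f(4)S₂(2) + f(5)S₂(3)` with `S₂(2) = 2 + χ(2)`,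
  `S₂(3) = 3 + 2χ(2) + χ(3)`, of absolute value `≤ 9f(4) − 6f(5)` for a REAL `χ` (`χ(2), χ(3) ∈ {0, ±1}`;
  `norm_boundary_four_le`) — together with the `9f(4) − 6f(5) = 10f(4) − 5f(5) − f(4) − f(5)` of the head
  this is the printed `18f(4) − 12f(5)`; and `√q/2 = (A + 1 + θ)/2` with **`θ := √q − ⌊√q⌋`** turns
  `−(A(A+3)/2)f(A+1) + (A(A+1)/2)f(A+2) + (√q/2)[(A+1)f(A+1) − Af(A+2)]` into the printed
  `−(A/2)f(A) + (A/2){f(A) − f(A+1)} + ½f(A+1) + (θ/2){…}` (an identity; `bordignon2020_theorem21` holds for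
  EVERY `A ≥ 5` with `θ = √q − (A+1)`, and `theta_mem_Ico_of_nat_sqrt` records `θ ∈ [0,1)` at `A + 1 = ⌊√q⌋`).
  So the printed statement is exactly recovered, for real even primitive `χ` — the case used in print (Thm 1.1).
* The series `∑_{n≥4}` is rendered as the limit `Λ` of the partial sums `∑_{n=4}^{N}` (hypothesis
  `Tendsto … (𝓝 Λ)`), the finite-`N` bound `norm_sum_mul_apply_le_secondOrder` carrying the extra boundary
  `2q√q·f(N−1)` (from `|S₂| ≤ q√q/2`), which tends to `0` with `f`.
* `sum_mul_apply_eq_secondOrder` — the identity (8) with `k = 4` in finite form (induction on `N`).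

## References

* [Bordignon2020] Theorem 2.1 and its proof, (8), pp. 4–5.
* [Louboutin2002EvenL1] Lemma 10 (37) (tree: `two_mul_norm_doubleSum_le`).
* S. Louboutin, C. R. Acad. Sci. Paris 332 (2001) 95–98, Theorem 1 (not held; acq-13733).
-/

noncomputable section

open Finset Complex Filter Topology

namespace Literature.NumberTheory.LFunctions.DirichletAbel

/-! ### Real bookkeeping: second differences against `m(m+1)/2` and against `m` -/

section RealLemmas

variable (f : ℕ → ℝ)

/-- `a_n = f(n) − 2f(n+1) + f(n+2)`. [cite: Bordignon2020, Theorem 2.1 (proof, a_n)] -/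
def secondDiff (n : ℕ) : ℝ := f n - 2 * f (n + 1) + f (n + 2)

/-- **`∑_{m=4}^{A} (m(m+1)/2) a_m = ∑_{m=6}^{A} f(m) + 10f(4) − 5f(5) − (A(A+3)/2) f(A+1) + (A(A+1)/2) f(A+2)`**
for `A ≥ 5` (Bordignon's display with `k = 4`; summation by parts twice). Sums over `Ico 4 (A+1)`,
`Ico 6 (A+1)`. [cite: Bordignon2020, Theorem 2.1 (proof)] -/
theorem sum_triangular_mul_secondDiff {A : ℕ} (hA : 5 ≤ A) :
    ∑ m ∈ Ico 4 (A + 1), ((m : ℝ) * (m + 1) / 2) * secondDiff f m =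
      (∑ m ∈ Ico 6 (A + 1), f m) + 10 * f 4 - 5 * f 5 - ((A : ℝ) * (A + 3) / 2) * f (A + 1) +
        ((A : ℝ) * (A + 1) / 2) * f (A + 2) := by
  induction A, hA using Nat.le_induction with
  | base =>
    have h1 : Ico 4 (5 + 1) = {4, 5} := by decide
    have h2 : Ico 6 (5 + 1) = ∅ := by decide
    rw [h1, h2, sum_pair (by norm_num), sum_empty]
    simp only [secondDiff]
    norm_num
    ring
  | succ A hA ih =>
    rw [Finset.sum_Ico_succ_top (show 4 ≤ A + 1 by omega), ih,
      Finset.sum_Ico_succ_top (show 6 ≤ A + 1 by omega) (f := fun m => f m)]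
    simp only [secondDiff, show A + 1 + 1 = A + 2 by ring, show A + 1 + 2 = A + 3 by ring]
    push_cast
    ring

/-- **`∑_{m=L}^{L+j} m a_m = L f(L) − (L−1) f(L+1) − ((L+j+1) f(L+j+1) − (L+j) f(L+j+2))`** (telescoping).
[cite: Bordignon2020, Theorem 2.1 (proof)] -/
theorem sum_nat_mul_secondDiff (L j : ℕ) :
    ∑ m ∈ Ico L (L + j + 1), (m : ℝ) * secondDiff f m =
      (L : ℝ) * f L - ((L : ℝ) - 1) * f (L + 1) -
        (((L + j : ℕ) : ℝ) + 1) * f (L + j + 1) + ((L + j : ℕ) : ℝ) * f (L + j + 2) := by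
  induction j with
  | zero =>
    rw [show L + 0 + 1 = L + 1 by ring, Nat.Ico_succ_singleton, sum_singleton]
    simp only [secondDiff, show L + 0 = L by ring]
    ring
  | succ j ih =>
    rw [show L + (j + 1) + 1 = L + j + 1 + 1 by ring, Finset.sum_Ico_succ_top (show L ≤ L + j + 1 by omega), ih]
    simp only [secondDiff, show L + (j + 1) = L + j + 1 by ring, show L + j + 1 + 1 = L + j + 2 by ring,
      show L + j + 1 + 2 = L + j + 3 by ring]
    push_cast
    ring

/-- With `f ≥ 0` and non-increasing from `L ≥ 1` on: **`∑_{m=L}^{M} m a_m ≤ L f(L) − (L−1) f(L+1)`**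
(`= (L−1)(f(L) − f(L+1)) + f(L)`). [cite: Bordignon2020, Theorem 2.1 (proof)] -/
theorem sum_nat_mul_secondDiff_le {L : ℕ} (j : ℕ) (hf0 : ∀ n, L ≤ n → 0 ≤ f n)
    (hmono : ∀ n, L ≤ n → f (n + 1) ≤ f n) :
    ∑ m ∈ Ico L (L + j + 1), (m : ℝ) * secondDiff f m ≤ (L : ℝ) * f L - ((L : ℝ) - 1) * f (L + 1) := by
  rw [sum_nat_mul_secondDiff]
  have h1 := hmono (L + j + 1) (by omega)
  have h2 := hf0 (L + j + 1) (by omega)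
  have h3 : (0 : ℝ) ≤ ((L + j : ℕ) : ℝ) := Nat.cast_nonneg _
  rw [show L + j + 1 + 1 = L + j + 2 by ring] at h1
  nlinarith

end RealLemmas

/-! ### The double Abel identity from `n = 4` -/

variable {q : ℕ} [NeZero q] (χ : DirichletCharacter ℂ q)

omit [NeZero q] in
/-- **Second-order partial summation (Bordignon's (8) with `k = 4`), finite form:** for `N = M + 5`,
`∑_{n=4}^{N} f(n)χ(n) = ∑_{m=4}^{N−2} a_m S₂(m) + [f(N−1)S₂(N−1) + f(N)S₂(N) − 2f(N)S₂(N−1)]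
 + [−2f(4)S₂(3) + f(4)S₂(2) + f(5)S₂(3)]` (from `χ(n) = S₂(n) − 2S₂(n−1) + S₂(n−2)`).
[cite: Bordignon2020, Theorem 2.1 (proof, (8))] -/
theorem sum_mul_apply_eq_secondOrder (f : ℕ → ℝ) (M : ℕ) :
    ∑ n ∈ Ico 4 (M + 6), (f n : ℂ) * χ (n : ZMod q) =
      (∑ m ∈ Ico 4 (M + 4), (secondDiff f m : ℂ) * doubleSum χ m) +
        ((f (M + 4) : ℂ) * doubleSum χ (M + 4) + (f (M + 5) : ℂ) * doubleSum χ (M + 5) -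
          2 * (f (M + 5) : ℂ) * doubleSum χ (M + 4)) +
        (-2 * (f 4 : ℂ) * doubleSum χ 3 + (f 4 : ℂ) * doubleSum χ 2 + (f 5 : ℂ) * doubleSum χ 3) := by
  induction M with
  | zero =>
    have h1 : Ico 4 (0 + 6) = {4, 5} := by decide
    have h2 : Ico 4 (0 + 4) = ∅ := by decide
    rw [h1, h2, sum_pair (by norm_num), sum_empty]
    have e4 := doubleSum_second_difference χ 2
    have e5 := doubleSum_second_difference χ 3
    norm_num at e4 e5 ⊢
    rw [← e4, ← e5]
    ring
  | succ M ih =>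
    have e := doubleSum_second_difference χ (M + 4)
    rw [show M + 4 + 2 = M + 6 by ring, show M + 4 + 1 = M + 5 by ring] at e
    have i6 : M + 1 + 6 = M + 6 + 1 := by ring
    have i4 : M + 1 + 4 = M + 4 + 1 := by ring
    have i5 : M + 1 + 5 = M + 6 := by ring
    rw [i6, i4, i5, Finset.sum_Ico_succ_top (show 4 ≤ M + 6 by omega),
      Finset.sum_Ico_succ_top (show 4 ≤ M + 4 by omega), ih, ← e]
    simp only [secondDiff, show M + 4 + 1 = M + 5 by ring, show M + 4 + 2 = M + 6 by ring]
    push_cast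
    ring

/-! ### The bound -/

omit [NeZero q] in
/-- A quadratic character takes real values in `[−1, 1]`. [folklore] -/
private theorem exists_real_of_isQuadratic (hquad : χ.IsQuadratic) (a : ZMod q) :
    ∃ r : ℝ, χ a = r ∧ -1 ≤ r ∧ r ≤ 1 := by
  rcases hquad a with h | h | h
  · exact ⟨0, by simp [h], by norm_num, by norm_num⟩
  · exact ⟨1, by simp [h], by norm_num, by norm_num⟩
  · exact ⟨-1, by simp [h], by norm_num, by norm_num⟩

omit [NeZero q] in
/-- `S₂(2) = 2 + χ(2)` and `S₂(3) = 3 + 2χ(2) + χ(3)`. [cite: Bordignon2020, Theorem 2.1 (proof)] -/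
theorem doubleSum_two_three :
    doubleSum χ 2 = 2 + χ (2 : ZMod q) ∧ doubleSum χ 3 = 3 + 2 * χ (2 : ZMod q) + χ (3 : ZMod q) := by
  simp only [doubleSum, partialSum, sum_range_succ, sum_range_zero]
  norm_num
  constructor <;> ring

omit [NeZero q] in
/-- The small-index boundary term for a REAL character: with `0 ≤ f(5) ≤ f(4)`,
`‖−2f(4)S₂(3) + f(4)S₂(2) + f(5)S₂(3)‖ ≤ 9f(4) − 6f(5)` (`S₂(2) = 2 + χ(2)`, `S₂(3) = 3 + 2χ(2) + χ(3)`,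
`χ(2), χ(3) ∈ {0, ±1}`; the extreme case is `χ(2) = χ(3) = 1`). [cite: Bordignon2020, Theorem 2.1 (18f(4) − 12f(5))] -/
theorem norm_boundary_four_le (hquad : χ.IsQuadratic) {f4 f5 : ℝ} (h45 : f5 ≤ f4) (h5 : 0 ≤ f5) :
    ‖-2 * (f4 : ℂ) * doubleSum χ 3 + (f4 : ℂ) * doubleSum χ 2 + (f5 : ℂ) * doubleSum χ 3‖ ≤
      9 * f4 - 6 * f5 := by
  obtain ⟨h2, h3⟩ := doubleSum_two_three χ
  obtain ⟨x, hx, hx1, hx2⟩ := exists_real_of_isQuadratic χ hquad 2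
  obtain ⟨y, hy, hy1, hy2⟩ := exists_real_of_isQuadratic χ hquad 3
  rw [h2, h3, hx, hy]
  have key : -2 * (f4 : ℂ) * (3 + 2 * (x : ℂ) + y) + (f4 : ℂ) * (2 + x) + (f5 : ℂ) * (3 + 2 * x + y) =
      ((-(f4 * (4 + 3 * x + 2 * y)) + f5 * (3 + 2 * x + y) : ℝ) : ℂ) := by
    push_cast; ring
  rw [key, Complex.norm_real, Real.norm_eq_abs, abs_le]
  constructor <;> nlinarith [mul_nonneg (sub_nonneg.2 h45) (by linarith : (0:ℝ) ≤ 3 + 2 * x + y),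
    mul_nonneg h5 (by linarith : (0:ℝ) ≤ 4 + x + y), mul_nonneg h5 (by linarith : (0:ℝ) ≤ 2 - x - y),
    mul_nonneg (sub_nonneg.2 h45) (by linarith : (0:ℝ) ≤ 5 - 3 * x - 2 * y)]

/-- **The finite second-order bound.** `χ` primitive, real, even mod `q > 1`; `f ≥ 0` non-increasing with
non-negative second differences on `[4, ∞)`; `5 ≤ A ≤ M + 2`. Then
`‖∑_{n=4}^{M+5} f(n)χ(n)‖ ≤ [∑_{m=6}^{A} f(m) + 10f(4) − 5f(5) − (A(A+3)/2)f(A+1) + (A(A+1)/2)f(A+2)]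
 + (√q/2)·[(A+1)f(A+1) − A f(A+2)] + [9f(4) − 6f(5)] + 2q√q·f(M+4)`: the head `m ≤ A` by
`|S₂(m)| ≤ m(m+1)/2`, the tail `m > A` by `2|S₂(m)| ≤ m√q` (Louboutin's Lemma 10), the boundary at `N`
by `|S₂| ≤ q√q/2`. [cite: Bordignon2020, Theorem 2.1 (proof)] [cite: Louboutin2002EvenL1, Lemma 10 (37)] -/
theorem norm_sum_mul_apply_le_secondOrder (hq : 1 < q) (hχ : χ.IsPrimitive) (hquad : χ.IsQuadratic)
    (heven : χ.Even) (f : ℕ → ℝ) (hf0 : ∀ n, 4 ≤ n → 0 ≤ f n) (hmono : ∀ n, 4 ≤ n → f (n + 1) ≤ f n)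
    (hconv : ∀ n, 4 ≤ n → 0 ≤ secondDiff f n) {A M : ℕ} (hA : 5 ≤ A) (hAM : A ≤ M + 2) :
    ‖∑ n ∈ Ico 4 (M + 6), (f n : ℂ) * χ (n : ZMod q)‖ ≤
      ((∑ m ∈ Ico 6 (A + 1), f m) + 10 * f 4 - 5 * f 5 - ((A : ℝ) * (A + 3) / 2) * f (A + 1) +
          ((A : ℝ) * (A + 1) / 2) * f (A + 2)) +
        Real.sqrt q / 2 * (((A : ℝ) + 1) * f (A + 1) - (A : ℝ) * f (A + 2)) +
        (9 * f 4 - 6 * f 5) + 2 * q * Real.sqrt q * f (M + 4) := by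
  rw [sum_mul_apply_eq_secondOrder χ f M]
  have hS : 0 ≤ Real.sqrt q := Real.sqrt_nonneg _
  -- split the `a_m S₂(m)` sum at `A`
  rw [← sum_Ico_consecutive _ (show 4 ≤ A + 1 by omega) (show A + 1 ≤ M + 4 by omega)]
  -- head
  have hhead : ‖∑ m ∈ Ico 4 (A + 1), (secondDiff f m : ℂ) * doubleSum χ m‖ ≤
      (∑ m ∈ Ico 6 (A + 1), f m) + 10 * f 4 - 5 * f 5 - ((A : ℝ) * (A + 3) / 2) * f (A + 1) +
        ((A : ℝ) * (A + 1) / 2) * f (A + 2) := by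
    rw [← sum_triangular_mul_secondDiff f hA]
    refine (norm_sum_le _ _).trans (sum_le_sum fun m hm => ?_)
    have hm4 : 4 ≤ m := (mem_Ico.mp hm).1
    rw [norm_mul, Complex.norm_real, Real.norm_eq_abs, abs_of_nonneg (hconv m hm4), mul_comm]
    have := norm_doubleSum_le_triangle χ m
    have hc := hconv m hm4
    calc ‖doubleSum χ m‖ * secondDiff f m ≤ ((m : ℝ) * (m + 1) / 2) * secondDiff f m :=
          mul_le_mul_of_nonneg_right this hc
      _ = _ := rfl
  -- tail
  have htail : ‖∑ m ∈ Ico (A + 1) (M + 4), (secondDiff f m : ℂ) * doubleSum χ m‖ ≤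
      Real.sqrt q / 2 * (((A : ℝ) + 1) * f (A + 1) - (A : ℝ) * f (A + 2)) := by
    obtain ⟨j, hj⟩ : ∃ j, M + 4 = A + 1 + j + 1 := ⟨M + 2 - A, by omega⟩
    have hle := sum_nat_mul_secondDiff_le f (L := A + 1) j (fun n hn => hf0 n (by omega))
      (fun n hn => hmono n (by omega))
    rw [← hj] at hle
    refine (norm_sum_le _ _).trans ?_
    calc ∑ m ∈ Ico (A + 1) (M + 4), ‖(secondDiff f m : ℂ) * doubleSum χ m‖
        ≤ ∑ m ∈ Ico (A + 1) (M + 4), secondDiff f m * ((m : ℝ) * Real.sqrt q / 2) := by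
          refine sum_le_sum fun m hm => ?_
          have hm4 : 4 ≤ m := by have := (mem_Ico.mp hm).1; omega
          rw [norm_mul, Complex.norm_real, Real.norm_eq_abs, abs_of_nonneg (hconv m hm4)]
          refine mul_le_mul_of_nonneg_left ?_ (hconv m hm4)
          have := two_mul_norm_doubleSum_le χ hq hχ heven m
          linarith
      _ = Real.sqrt q / 2 * ∑ m ∈ Ico (A + 1) (M + 4), (m : ℝ) * secondDiff f m := by
          rw [mul_sum]; refine sum_congr rfl fun m _ => ?_; ring
      _ ≤ Real.sqrt q / 2 * (((A : ℝ) + 1) * f (A + 1) - (A : ℝ) * f (A + 2)) := by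
          refine mul_le_mul_of_nonneg_left ?_ (by positivity)
          rw [show A + 1 + 1 = A + 2 by ring] at hle
          push_cast at hle
          linarith
  -- boundary at `N`
  have hE : ‖(f (M + 4) : ℂ) * doubleSum χ (M + 4) + (f (M + 5) : ℂ) * doubleSum χ (M + 5) -
      2 * (f (M + 5) : ℂ) * doubleSum χ (M + 4)‖ ≤ 2 * q * Real.sqrt q * f (M + 4) := by
    have hC4 := norm_doubleSum_le_uniform χ hq hχ heven (M + 4)
    have hC5 := norm_doubleSum_le_uniform χ hq hχ heven (M + 5)
    have hf4 := hf0 (M + 4) (by omega)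
    have hf5 := hf0 (M + 5) (by omega)
    have hf54 : f (M + 5) ≤ f (M + 4) := hmono (M + 4) (by omega)
    calc ‖(f (M + 4) : ℂ) * doubleSum χ (M + 4) + (f (M + 5) : ℂ) * doubleSum χ (M + 5) -
          2 * (f (M + 5) : ℂ) * doubleSum χ (M + 4)‖
        ≤ ‖(f (M + 4) : ℂ) * doubleSum χ (M + 4)‖ + ‖(f (M + 5) : ℂ) * doubleSum χ (M + 5)‖ +
            ‖2 * (f (M + 5) : ℂ) * doubleSum χ (M + 4)‖ := norm_sub_le_of_le (norm_add_le _ _) le_rfl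
      _ = f (M + 4) * ‖doubleSum χ (M + 4)‖ + f (M + 5) * ‖doubleSum χ (M + 5)‖ +
            2 * f (M + 5) * ‖doubleSum χ (M + 4)‖ := by
          simp only [norm_mul, Complex.norm_real, Real.norm_eq_abs, abs_of_nonneg hf4, abs_of_nonneg hf5,
            Complex.norm_ofNat]
      _ ≤ f (M + 4) * ((q : ℝ) * Real.sqrt q / 2) + f (M + 4) * ((q : ℝ) * Real.sqrt q / 2) +
            2 * f (M + 4) * ((q : ℝ) * Real.sqrt q / 2) := by
          gcongr
      _ = 2 * q * Real.sqrt q * f (M + 4) := by ring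
  -- boundary at `4`
  have hB := norm_boundary_four_le χ hquad (hmono 4 le_rfl) (hf0 5 (by norm_num))
  -- assemble
  calc ‖(∑ m ∈ Ico 4 (A + 1), (secondDiff f m : ℂ) * doubleSum χ m +
          ∑ m ∈ Ico (A + 1) (M + 4), (secondDiff f m : ℂ) * doubleSum χ m) +
        ((f (M + 4) : ℂ) * doubleSum χ (M + 4) + (f (M + 5) : ℂ) * doubleSum χ (M + 5) -
          2 * (f (M + 5) : ℂ) * doubleSum χ (M + 4)) +
        (-2 * (f 4 : ℂ) * doubleSum χ 3 + (f 4 : ℂ) * doubleSum χ 2 + (f 5 : ℂ) * doubleSum χ 3)‖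
      ≤ (‖∑ m ∈ Ico 4 (A + 1), (secondDiff f m : ℂ) * doubleSum χ m‖ +
          ‖∑ m ∈ Ico (A + 1) (M + 4), (secondDiff f m : ℂ) * doubleSum χ m‖) +
        ‖(f (M + 4) : ℂ) * doubleSum χ (M + 4) + (f (M + 5) : ℂ) * doubleSum χ (M + 5) -
          2 * (f (M + 5) : ℂ) * doubleSum χ (M + 4)‖ +
        ‖-2 * (f 4 : ℂ) * doubleSum χ 3 + (f 4 : ℂ) * doubleSum χ 2 + (f 5 : ℂ) * doubleSum χ 3‖ :=
        (norm_add_le _ _).trans (add_le_add ((norm_add_le _ _).trans (add_le_add (norm_add_le _ _) le_rfl))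
          le_rfl)
    _ ≤ _ := by linarith

/-! ### The bound for the whole series `∑_{n ≥ 4} f(n)χ(n)` (as the limit of its partial sums) -/

/-- **Second-order partial summation bound for the series** `Λ = lim_N ∑_{n=4}^{N} f(n)χ(n)`: under the
hypotheses of `norm_sum_mul_apply_le_secondOrder` and `f(n) → 0`, for every `A ≥ 5`,
`‖Λ‖ ≤ [∑_{m=6}^{A} f + 10f(4) − 5f(5) − (A(A+3)/2)f(A+1) + (A(A+1)/2)f(A+2)] + (√q/2)[(A+1)f(A+1) − Af(A+2)]
 + 9f(4) − 6f(5)`. [cite: Bordignon2020, Theorem 2.1] [cite: Louboutin2002EvenL1, Lemma 10 (37)] -/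
theorem norm_lim_le_secondOrder (hq : 1 < q) (hχ : χ.IsPrimitive) (hquad : χ.IsQuadratic)
    (heven : χ.Even) (f : ℕ → ℝ) (hf0 : ∀ n, 4 ≤ n → 0 ≤ f n) (hmono : ∀ n, 4 ≤ n → f (n + 1) ≤ f n)
    (hconv : ∀ n, 4 ≤ n → 0 ≤ secondDiff f n) (hlim : Tendsto f atTop (𝓝 0)) {A : ℕ} (hA : 5 ≤ A)
    {Λ : ℂ} (hΛ : Tendsto (fun M : ℕ => ∑ n ∈ Ico 4 (M + 6), (f n : ℂ) * χ (n : ZMod q)) atTop (𝓝 Λ)) :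
    ‖Λ‖ ≤ ((∑ m ∈ Ico 6 (A + 1), f m) + 10 * f 4 - 5 * f 5 - ((A : ℝ) * (A + 3) / 2) * f (A + 1) +
          ((A : ℝ) * (A + 1) / 2) * f (A + 2)) +
        Real.sqrt q / 2 * (((A : ℝ) + 1) * f (A + 1) - (A : ℝ) * f (A + 2)) + (9 * f 4 - 6 * f 5) := by
  set R : ℝ := ((∑ m ∈ Ico 6 (A + 1), f m) + 10 * f 4 - 5 * f 5 - ((A : ℝ) * (A + 3) / 2) * f (A + 1) +
          ((A : ℝ) * (A + 1) / 2) * f (A + 2)) +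
        Real.sqrt q / 2 * (((A : ℝ) + 1) * f (A + 1) - (A : ℝ) * f (A + 2)) + (9 * f 4 - 6 * f 5) with hR
  have h1 : Tendsto (fun M : ℕ => ‖∑ n ∈ Ico 4 (M + 6), (f n : ℂ) * χ (n : ZMod q)‖) atTop (𝓝 ‖Λ‖) :=
    hΛ.norm
  have h2 : Tendsto (fun M : ℕ => R + 2 * q * Real.sqrt q * f (M + 4)) atTop (𝓝 (R + 2 * q * Real.sqrt q * 0)) :=
    ((hlim.comp (tendsto_add_atTop_nat 4)).const_mul _).const_add _
  rw [mul_zero, add_zero] at h2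
  refine le_of_tendsto_of_tendsto h1 h2 ?_
  filter_upwards [eventually_ge_atTop A] with M hM
  have := norm_sum_mul_apply_le_secondOrder χ hq hχ hquad heven f hf0 hmono hconv hA (by omega : A ≤ M + 2)
  rw [hR]; linarith

/-- **Bordignon, J. Number Theory 210 (2020), Theorem 2.1 (= Louboutin, C. R. Acad. Sci. 332 (2001) Thm 1
with the sums started at 4) — PROVED, in the shape printed:** «Take `χ` a even primitive Dirichlet
character, with conductor `q`. Let `A := ⌊√q⌋ − 1`. Let `f` be defined in `[4,∞)`, `↘ 0` and such that
`f(n) − 2f(n+1) + f(n+2) ≥ 0` for all `n ≥ 4`. Then, with `0 ≤ θ ≤ 1`,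
`|∑_{4}^{∞} χ(n) f(n)| ≤ (∑_{4}^{A} f(n)) − (A/2)f(A) + (A/2){f(A) − f(A+1)} + ½f(A+1)
 + (θ/2){(A+1)(f(A+1) − f(A+2)) + f(A+2)} + 18f(4) − 12f(5)`.» Typed for a REAL (quadratic) even
primitive `χ` (the use in print; realness enters the constant `18f(4) − 12f(5)` through `χ(2), χ(3) ∈ {0,±1}`),
the series as the limit `Λ` of its partial sums, and with `θ = √q − (A+1)` made explicit: the inequality
holds for EVERY integer `A ≥ 5` with this `θ` (for the printed `A = ⌊√q⌋ − 1`, `θ = √q − ⌊√q⌋ ∈ [0,1)`: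
`theta_mem_Ico_of_nat_sqrt`). Inputs: `|S₂(n)| ≤ n(n+1)/2` (`n ≤ A`), `2|S₂(n)| ≤ n√q` (`n > A`, Louboutin's
Lemma 10 / Hua), `q`-periodicity of `S₂`. [cite: Bordignon2020, Theorem 2.1] [cite: Louboutin2002EvenL1, Lemma 10 (37)] -/
theorem bordignon2020_theorem21 (hq : 1 < q) (hχ : χ.IsPrimitive) (hquad : χ.IsQuadratic)
    (heven : χ.Even) (f : ℕ → ℝ) (hf0 : ∀ n, 4 ≤ n → 0 ≤ f n) (hmono : ∀ n, 4 ≤ n → f (n + 1) ≤ f n)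
    (hconv : ∀ n, 4 ≤ n → 0 ≤ f n - 2 * f (n + 1) + f (n + 2)) (hlim : Tendsto f atTop (𝓝 0))
    {A : ℕ} (hA : 5 ≤ A) {Λ : ℂ}
    (hΛ : Tendsto (fun M : ℕ => ∑ n ∈ Ico 4 (M + 6), (f n : ℂ) * χ (n : ZMod q)) atTop (𝓝 Λ)) :
    ‖Λ‖ ≤ (∑ n ∈ Ico 4 (A + 1), f n) - (A : ℝ) / 2 * f A + (A : ℝ) / 2 * (f A - f (A + 1)) +
        1 / 2 * f (A + 1) +
        (Real.sqrt q - (A + 1)) / 2 * (((A : ℝ) + 1) * (f (A + 1) - f (A + 2)) + f (A + 2)) +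
        18 * f 4 - 12 * f 5 := by
  have h := norm_lim_le_secondOrder χ hq hχ hquad heven f hf0 hmono hconv hlim hA hΛ
  -- `∑_{Ico 4 (A+1)} f = f 4 + f 5 + ∑_{Ico 6 (A+1)} f`
  have hsplit : ∑ n ∈ Ico 4 (A + 1), f n = f 4 + f 5 + ∑ n ∈ Ico 6 (A + 1), f n := by
    rw [Finset.sum_eq_sum_Ico_succ_bot (show 4 < A + 1 by omega),
      Finset.sum_eq_sum_Ico_succ_bot (show 5 < A + 1 by omega)]
    ring
  rw [hsplit]
  have : ((∑ m ∈ Ico 6 (A + 1), f m) + 10 * f 4 - 5 * f 5 - ((A : ℝ) * (A + 3) / 2) * f (A + 1) +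
          ((A : ℝ) * (A + 1) / 2) * f (A + 2)) +
        Real.sqrt q / 2 * (((A : ℝ) + 1) * f (A + 1) - (A : ℝ) * f (A + 2)) + (9 * f 4 - 6 * f 5) =
      (f 4 + f 5 + ∑ n ∈ Ico 6 (A + 1), f n) - (A : ℝ) / 2 * f A + (A : ℝ) / 2 * (f A - f (A + 1)) +
        1 / 2 * f (A + 1) +
        (Real.sqrt q - (A + 1)) / 2 * (((A : ℝ) + 1) * (f (A + 1) - f (A + 2)) + f (A + 2)) +
        18 * f 4 - 12 * f 5 := by ring
  linarith

omit [NeZero q] in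
/-- For the printed choice `A + 1 = ⌊√q⌋`: `θ = √q − ⌊√q⌋ ∈ [0, 1)`. [cite: Bordignon2020, Theorem 2.1 (0 ≤ θ ≤ 1)] -/
theorem theta_mem_Ico_of_nat_sqrt {A : ℕ} (hA : A + 1 = Nat.sqrt q) :
    0 ≤ Real.sqrt q - ((A : ℝ) + 1) ∧ Real.sqrt q - ((A : ℝ) + 1) < 1 := by
  have h1 : ((Nat.sqrt q : ℕ) : ℝ) ≤ Real.sqrt q := Real.nat_sqrt_le_real_sqrt
  have h2 : Real.sqrt q < (Nat.sqrt q : ℝ) + 1 := Real.real_sqrt_lt_nat_sqrt_succ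
  have hA' : ((A : ℝ) + 1) = (Nat.sqrt q : ℝ) := by exact_mod_cast hA
  rw [hA']
  constructor <;> linarith

end Literature.NumberTheory.LFunctions.DirichletAbel

end
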